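import Literature.IUT.HodgeArakelov.ThetaEvaluationSetting
import Literature.IUT.HodgeArakelov.MonoThetaProjective

/-!
# [IUTchII] Prop 2.2 (i), repaired typing `Prop22_i'` (reference data pinned, `ι` = the pointed inversion)

Repair file (abc-iut cell; RQ7 finding F4 of abc-iut-L6-d1 on p407103, abc-iut-L6-lead's ruling
2026-08-25T20:42:11Z (2)). The landed `Prop22_i T D := Nonempty (SubgraphDecomposition S T D)` holds for
every input (`prop22_i_trivial`, `ThetaEvaluationSettingNegative.lean`): the reference decomposition groups
`refTri`, `refBullet` are free fields of `SubgraphDecomposition` and `ι` is only asked to stabilise the chosen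
subgroups (so `ι = id` qualifies). Here (1) the reference data are PINNED — a `SubgraphReference S` in the
reference group `Π^tp_{X̲̲_v} = S.PiX`: the decomposition groups `Π^tp_{X,Γ▶} ⊇ Π^tp_{X,Γ•}` of [IUTchI]
Cor. 2.3 (iii) (TODO-merge:abc-iut-L5-t1) inside `Π^tp_{Y̲_v}` — and (2) `ι` is TIED to the Rmk. 1.4.1 (ii)
datum as landed (`PointedInversion`, `MonoThetaProjective.lean`, p407497): `ι` is a representative of the
`Δ`-outer class of the pointed inversion `ι_X̲̲` (print, p. 66: "`ι := ι_Ÿ` [cf. Remarks 1.4.1, (ii); 2.1.1,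
(ii)] … chosen so that some representative of `ι` stabilizes `Π_{v•}` and `Π_{v▶}`"). The printed sentence

  [IUTchII] Prop. 2.2 (i), kurims p. 66: "The collection of data `(Π_{v•} ⊆ Π_{v▶} ⊆ Π_v, ι)`, regarded up to
  `Π_v`-conjugacy, may be reconstructed via a functorial group-theoretic algorithm from the topological
  group `Π_v`."

is typed as `Prop22_i' R E ι₀ T D`: (existence) some `SubgraphDecomposition` LIES OVER `(R, ι₀)` — its pair
`(Π_{v▶}, Π_{v•})` is the transport of the reference pair along an isomorphism `Π_v ≅ Π^tp_{X̲̲_v}` up to a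
common `Π^tp_{X̲̲_v}`-conjugation, and its `ι` lies in the `Δ`-outer class of the pointed inversion `ι₀` — and
(well-definedness "up to `Π_v`-conjugacy") any two such have SIMULTANEOUSLY `Π_v`-conjugate pairs. Neither
clause is provable over the interface: existence includes the printed "we may assume … some representative
of `ι` stabilizes `Π_{v•}` and `Π_{v▶}`", and well-definedness is exactly the group-theoreticity of the
reference pair under `Aut(Π^tp_{X̲̲_v})` (`SubgraphReference.GroupTheoretic`, the [SemiAnbd] Cor. 3.11 /
[AbsTopI] Thm. 2.14 (i) input of the printed proof, p. 67), from which the second clause is PROVED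
(`SubgraphReference.GroupTheoretic.conj_of_liesOver`). ANTI-VACUITY: a datum lying over `(R, ι₀)` never has
`ι` `Δ`-inner, in particular `ι ≠ id` (`LiesOver.iota_ne_refl`) — the F4 witness is excluded.

Claim key `Mochizuki2012`, status DISPUTED (D-0012): typing and transport bookkeeping only; nothing here
takes a side on [IUTchIII] Cor. 3.12 (typed ≠ discharged).
-/

namespace Literature.IUT.HodgeArakelov

universe u

variable {S : BadPlaceSetting.{u}} {P : TopGroup.{u}}

/-- **IUTchII:Prop2.2** reference data (kurims p. 66) in `Π^tp_{X̲̲_v}`: "the decomposition groups determined,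
respectively, by the subgraphs `Γ•_X` and `Γ▶_X` — i.e., more precisely, the group `Π^tp_{X,ℍ}` of [IUTchI],
Corollary 2.3, (iii)", a nested pair ("once one fixes `Π_{v▶}`, then the subgroup `Π_{v•} ⊆ Π_{v▶}` is
well-defined up to `Π_{v▶}`-conjugacy") with `Π_{v▶} ⊆ Π^tp_{Y_v} ∩ Π_v = Π^tp_{Y̲_v}`. INTERFACE data
(TODO-merge:abc-iut-L5-t1, [IUTchI] Cor. 2.3 (iii)). [claim: Mochizuki2012, status: disputed] -/
structure SubgraphReference (S : BadPlaceSetting.{u}) : Type u where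
  /-- `Π^tp_{X,Γ▶} ⊇ Π^tp_{X,Γ•}` -/
  refTri : Subgroup S.PiX
  refBullet : Subgroup S.PiX
  refBullet_le : refBullet ≤ refTri
  /-- `Π_{v▶} ⊆ Π^tp_{Y̲_v}` (the pull-back of `Π^tp_{Y_v}`) -/
  refTri_le_Y : refTri ≤ S.refY.comap S.inclPlain

/-- A `SubgraphDecomposition` LIES OVER the reference pair `R` and the pointed inversion `ι₀` (Rmk. 1.4.1 (ii),
`PointedInversion`): its reference groups ARE `R`'s; along one isomorphism `e : Π_v ≅ Π^tp_{X̲̲_v}` its pair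
`(Π_{v▶}, Π_{v•})` is carried to a common `Π^tp_{X̲̲_v}`-conjugate of `(Π^tp_{X,Γ▶}, Π^tp_{X,Γ•})`; and its `ι`
is a representative of the `Δ`-outer class of `ι₀` ("`ι := ι_Ÿ` … some representative of `ι` stabilizes
`Π_{v•}` and `Π_{v▶}`", p. 66 — the stabilisation being the fields `iota_bullet`, `iota_tri`).
[claim: Mochizuki2012, status: disputed] -/
def SubgraphDecomposition.LiesOver {T : TemperedCoverings S P} {D : EtaleThetaData S.toThetaSetting P}
    (Dec : SubgraphDecomposition S T D) (R : SubgraphReference S) {E : EnvOfGroup S.toThetaSetting P}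
    (ι₀ : PointedInversion E D) : Prop :=
  Dec.refTri = R.refTri ∧ Dec.refBullet = R.refBullet ∧
    (∃ (e : P ≃ₜ* S.PiX) (g : S.PiX),
      Dec.Ptri.map e.toMulEquiv.toMonoidHom = R.refTri.map (MulAut.conj g).toMonoidHom ∧
      Dec.Pbullet.map e.toMulEquiv.toMonoidHom = R.refBullet.map (MulAut.conj g).toMonoidHom) ∧
    ∃ δ : P, E.recon.projG (E.isoX δ) = 1 ∧ ∀ x : P, Dec.iota x = δ * ι₀.iota x * δ⁻¹

/-- **IUTchII:Prop2.2(i)** (kurims p. 66), REPAIRED typing: over the pinned reference pair `R` and pointed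
inversion `ι₀`, (existence — including the printed "we may assume that `Π_{v•}`, `Π_{v▶}`, and `ι := ι_Ÿ` …
have been chosen so that some representative of `ι` stabilizes `Π_{v•}` and `Π_{v▶}`") some decomposition
datum lies over `(R, ι₀)`, and (well-definedness "regarded up to `Π_v`-conjugacy … reconstructed … from the
topological group `Π_v`") any two such have simultaneously `Π_v`-conjugate pairs `(Π_{v▶}, Π_{v•})`. Not
provable over the interface; the second clause follows from the anabelian input
`SubgraphReference.GroupTheoretic` (`conj_of_liesOver`). SCOPE NOTE: `ι`'s class is pinned to `ι₀`'s, whose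
own well-definedness is `PointedInversion.iota_unique`. [claim: Mochizuki2012, status: disputed] -/
def Prop22_i' (R : SubgraphReference S) {E : EnvOfGroup S.toThetaSetting P} (T : TemperedCoverings S P)
    (D : EtaleThetaData S.toThetaSetting P) (ι₀ : PointedInversion E D) : Prop :=
  (∃ Dec : SubgraphDecomposition S T D, Dec.LiesOver R ι₀) ∧
    ∀ Dec₁ Dec₂ : SubgraphDecomposition S T D, Dec₁.LiesOver R ι₀ → Dec₂.LiesOver R ι₀ →
      ∃ k : P, Dec₂.Ptri = Dec₁.Ptri.map (MulAut.conj k).toMonoidHom ∧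
        Dec₂.Pbullet = Dec₁.Pbullet.map (MulAut.conj k).toMonoidHom

/-- The anabelian INPUT of the printed proof of Prop. 2.2 (i) (p. 67: "dual graphs of stable models may be
reconstructed via a functorial group-theoretic algorithm from the corresponding tempered fundamental group
[[SemiAnbd], Corollary 3.11, or [AbsTopI], Theorem 2.14, (i)]"), in the form it is used: every automorphism
of the topological group `Π^tp_{X̲̲_v}` carries the pair `(Π^tp_{X,Γ▶}, Π^tp_{X,Γ•})` to a common conjugate.
Named predicate on the reference data (FACT-policy content; TODO-merge:abc-iut-L3 [SemiAnbd] Cor. 3.11).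
[claim: Mochizuki2012, status: disputed] -/
def SubgraphReference.GroupTheoretic (R : SubgraphReference S) : Prop :=
  ∀ φ : S.PiX ≃ₜ* S.PiX, ∃ g : S.PiX,
    R.refTri.map φ.toMulEquiv.toMonoidHom = R.refTri.map (MulAut.conj g).toMonoidHom ∧
      R.refBullet.map φ.toMulEquiv.toMonoidHom = R.refBullet.map (MulAut.conj g).toMonoidHom

/-! ### Proofs -/

section Helpers

variable {G H : Type u} [Group G] [Group H]

/-- Membership in the image of a subgroup under a conjugation automorphism. [folklore] -/
private theorem mem_map_conj {K : Subgroup G} {g x : G} :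
    x ∈ K.map (MulAut.conj g).toMonoidHom ↔ g⁻¹ * x * g ∈ K := by
  rw [Subgroup.mem_map_equiv, MulAut.conj_symm_apply]

/-- Membership in the image of a subgroup under a continuous multiplicative equivalence. [folklore] -/
private theorem mem_map_cme {G' H' : TopGroup.{u}} {K : Subgroup G'} (e : G' ≃ₜ* H') {y : H'} :
    y ∈ K.map e.toMulEquiv.toMonoidHom ↔ e.symm y ∈ K :=
  Subgroup.mem_map_equiv

end Helpers

variable {T : TemperedCoverings S P} {D : EtaleThetaData S.toThetaSetting P}
  {E : EnvOfGroup S.toThetaSetting P} {ι₀ : PointedInversion E D}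

/-- From `Dec.LiesOver R ι₀`: membership in `Π_{v▶}` / `Π_{v•}` is read off in the reference group.
[claim: Mochizuki2012, status: disputed] -/
theorem SubgraphDecomposition.LiesOver.mem_iff {Dec : SubgraphDecomposition S T D} {R : SubgraphReference S}
    (h : Dec.LiesOver R ι₀) :
    ∃ (e : P ≃ₜ* S.PiX) (g : S.PiX),
      (∀ x : P, x ∈ Dec.Ptri ↔ g⁻¹ * e x * g ∈ R.refTri) ∧
        (∀ x : P, x ∈ Dec.Pbullet ↔ g⁻¹ * e x * g ∈ R.refBullet) := by
  obtain ⟨_, _, ⟨e, g, htri, hbul⟩, _⟩ := h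
  refine ⟨e, g, fun x => ?_, fun x => ?_⟩
  · have := Subgroup.ext_iff.mp htri (e x)
    rw [mem_map_cme, mem_map_conj, ContinuousMulEquiv.symm_apply_apply] at this
    exact this
  · have := Subgroup.ext_iff.mp hbul (e x)
    rw [mem_map_cme, mem_map_conj, ContinuousMulEquiv.symm_apply_apply] at this
    exact this

/-- **IUTchII:Prop2.2(i)**, well-definedness clause PROVED from the anabelian input: if the reference pair is
group-theoretic, any two decomposition data lying over `(R, ι₀)` have simultaneously `Π_v`-conjugate pairs
`(Π_{v▶}, Π_{v•})` (the printed one-line proof, p. 67). [claim: Mochizuki2012, status: disputed] -/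
theorem SubgraphReference.GroupTheoretic.conj_of_liesOver {R : SubgraphReference S} (hG : R.GroupTheoretic)
    {Dec₁ Dec₂ : SubgraphDecomposition S T D} (h₁ : Dec₁.LiesOver R ι₀) (h₂ : Dec₂.LiesOver R ι₀) :
    ∃ k : P, Dec₂.Ptri = Dec₁.Ptri.map (MulAut.conj k).toMonoidHom ∧
      Dec₂.Pbullet = Dec₁.Pbullet.map (MulAut.conj k).toMonoidHom := by
  obtain ⟨e₁, g₁, htri₁, hbul₁⟩ := h₁.mem_iff
  obtain ⟨e₂, g₂, htri₂, hbul₂⟩ := h₂.mem_iff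
  -- `φ := e₂ ∘ e₁⁻¹ ∈ Aut(Π^tp_{X̲̲_v})`; apply group-theoreticity to `φ⁻¹ = e₁ ∘ e₂⁻¹`
  obtain ⟨g', htri', hbul'⟩ := hG (e₂.symm.trans e₁)
  -- `c := φ⁻¹(g₂)`
  set c : S.PiX := e₁ (e₂.symm g₂) with hc
  refine ⟨e₁.symm (c * g' * g₁⁻¹), Subgroup.ext fun x => ?_, Subgroup.ext fun x => ?_⟩
  · rw [htri₂, mem_map_conj, htri₁]
    have key : g₂⁻¹ * e₂ x * g₂ = (e₂.symm.trans e₁).symm (c⁻¹ * e₁ x * c) := by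
      apply (e₂.symm.trans e₁).injective
      rw [ContinuousMulEquiv.apply_symm_apply]
      show e₁ (e₂.symm (g₂⁻¹ * e₂ x * g₂)) = c⁻¹ * e₁ x * c
      rw [map_mul, map_mul, map_mul, map_mul, map_inv, map_inv, ContinuousMulEquiv.symm_apply_apply, hc]
    have step : g₂⁻¹ * e₂ x * g₂ ∈ R.refTri ↔ g'⁻¹ * (c⁻¹ * e₁ x * c) * g' ∈ R.refTri := by
      rw [key, ← mem_map_cme, htri', mem_map_conj]
    rw [step]
    have : g₁⁻¹ * e₁ ((e₁.symm (c * g' * g₁⁻¹))⁻¹ * x * e₁.symm (c * g' * g₁⁻¹)) * g₁ =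
        g'⁻¹ * (c⁻¹ * e₁ x * c) * g' := by
      rw [map_mul, map_mul, map_inv, ContinuousMulEquiv.apply_symm_apply]
      group
    rw [this]
  · rw [hbul₂, mem_map_conj, hbul₁]
    have key : g₂⁻¹ * e₂ x * g₂ = (e₂.symm.trans e₁).symm (c⁻¹ * e₁ x * c) := by
      apply (e₂.symm.trans e₁).injective
      rw [ContinuousMulEquiv.apply_symm_apply]
      show e₁ (e₂.symm (g₂⁻¹ * e₂ x * g₂)) = c⁻¹ * e₁ x * c
      rw [map_mul, map_mul, map_mul, map_mul, map_inv, map_inv, ContinuousMulEquiv.symm_apply_apply, hc]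
    have step : g₂⁻¹ * e₂ x * g₂ ∈ R.refBullet ↔ g'⁻¹ * (c⁻¹ * e₁ x * c) * g' ∈ R.refBullet := by
      rw [key, ← mem_map_cme, hbul', mem_map_conj]
    rw [step]
    have : g₁⁻¹ * e₁ ((e₁.symm (c * g' * g₁⁻¹))⁻¹ * x * e₁.symm (c * g' * g₁⁻¹)) * g₁ =
        g'⁻¹ * (c⁻¹ * e₁ x * c) * g' := by
      rw [map_mul, map_mul, map_inv, ContinuousMulEquiv.apply_symm_apply]
      group
    rw [this]

/-- The well-definedness clause of `Prop22_i'` is exactly what the anabelian input delivers: given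
`R.GroupTheoretic`, `Prop22_i'` reduces to its existence clause. [claim: Mochizuki2012, status: disputed] -/
theorem prop22_i'_iff_exists_of_groupTheoretic {R : SubgraphReference S} (hG : R.GroupTheoretic)
    (T : TemperedCoverings S P) (D : EtaleThetaData S.toThetaSetting P) (ι₀ : PointedInversion E D) :
    Prop22_i' R T D ι₀ ↔ ∃ Dec : SubgraphDecomposition S T D, Dec.LiesOver R ι₀ :=
  ⟨fun h => h.1, fun h => ⟨h, fun _ _ h₁ h₂ => hG.conj_of_liesOver h₁ h₂⟩⟩

/-- The SUBGROUP part of the existence clause is transport bookkeeping: along the identification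
`Π_v ≅ Π^tp_{X̲̲_v}` of Prop. 2.1 (`T.corresponds`), `e⁻¹(Π^tp_{X,Γ▶}) ⊆ Π^tp_{Y̲_v}` — the pulled-back reference
pair satisfies the subgroup constraints of `SubgraphDecomposition` (what is NOT bookkeeping is the choice of
`ι` in the class of `ι₀` stabilising them). [claim: Mochizuki2012, status: disputed] -/
theorem SubgraphReference.exists_transport (R : SubgraphReference S) (T : TemperedCoverings S P) :
    ∃ e : P ≃ₜ* S.PiX,
      R.refBullet.map e.symm.toMulEquiv.toMonoidHom ≤ R.refTri.map e.symm.toMulEquiv.toMonoidHom ∧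
      R.refTri.map e.symm.toMulEquiv.toMonoidHom ≤ T.YL ∧
      (R.refTri.map e.symm.toMulEquiv.toMonoidHom).map e.toMulEquiv.toMonoidHom = R.refTri ∧
      (R.refBullet.map e.symm.toMulEquiv.toMonoidHom).map e.toMulEquiv.toMonoidHom = R.refBullet := by
  obtain ⟨e, e', hcomm, hY, -⟩ := T.corresponds
  have memTri : ∀ x : P, x ∈ R.refTri.map e.symm.toMulEquiv.toMonoidHom ↔ e x ∈ R.refTri := fun x => by
    rw [mem_map_cme, ContinuousMulEquiv.symm_symm]
  have memBul : ∀ x : P, x ∈ R.refBullet.map e.symm.toMulEquiv.toMonoidHom ↔ e x ∈ R.refBullet :=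
    fun x => by rw [mem_map_cme, ContinuousMulEquiv.symm_symm]
  refine ⟨e, Subgroup.map_mono R.refBullet_le, fun x hx => ?_, Subgroup.ext fun z => ?_,
    Subgroup.ext fun z => ?_⟩
  · rw [memTri] at hx
    have h1 : S.inclPlain (e x) ∈ S.refY := R.refTri_le_Y hx
    rw [← hY] at h1
    obtain ⟨z, hz, hz'⟩ := h1
    rw [Subgroup.mem_comap]
    have : z = T.incl x := e'.injective (by rw [hcomm]; exact hz')
    exact this ▸ hz
  · rw [mem_map_cme, memTri, ContinuousMulEquiv.apply_symm_apply]
  · rw [mem_map_cme, memBul, ContinuousMulEquiv.apply_symm_apply]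

/-- ANTI-VACUITY: the repair bites the vacuity witness of `Prop22_i` (`exists_subgraphDecomposition_trivial`:
`ι = id`): a decomposition datum lying over `(R, ι₀)` never has `ι` inner by an element of `Δ` — because the
pointed inversion is not (`PointedInversion.iota_not_inner`). [claim: Mochizuki2012, status: disputed] -/
theorem SubgraphDecomposition.LiesOver.iota_not_inner {Dec : SubgraphDecomposition S T D}
    {R : SubgraphReference S} (h : Dec.LiesOver R ι₀) :
    ¬ ∃ p : P, E.recon.projG (E.isoX p) = 1 ∧ ∀ x, Dec.iota x = p * x * p⁻¹ := by
  obtain ⟨_, _, _, δ, hδ, hk⟩ := h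
  rintro ⟨p, hp, hall⟩
  apply ι₀.iota_not_inner
  refine ⟨δ⁻¹ * p, by rw [map_mul, map_mul, map_inv, map_inv, hδ, hp, inv_one, one_mul], fun x => ?_⟩
  have := (hk x).symm.trans (hall x)
  -- `δ ι₀(x) δ⁻¹ = p x p⁻¹`
  calc ι₀.iota x = δ⁻¹ * (δ * ι₀.iota x * δ⁻¹) * δ := by group
    _ = δ⁻¹ * (p * x * p⁻¹) * δ := by rw [this]
    _ = δ⁻¹ * p * x * (δ⁻¹ * p)⁻¹ := by group

/-- In particular the F4 witness (`ι = id`) lies over NO `(R, ι₀)`. [claim: Mochizuki2012, status: disputed] -/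
theorem SubgraphDecomposition.LiesOver.iota_ne_refl {Dec : SubgraphDecomposition S T D}
    {R : SubgraphReference S} (h : Dec.LiesOver R ι₀) : Dec.iota ≠ ContinuousMulEquiv.refl P := by
  intro hrefl
  exact h.iota_not_inner ⟨1, by rw [map_one, map_one], fun x => by
    rw [hrefl, inv_one, one_mul, mul_one]; rfl⟩

end Literature.IUT.HodgeArakelov
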